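import Literature.Probability.LatticeModels.SixVertexSpectralMeasureSpace
import Mathlib.Topology.UrysohnsLemma
import Mathlib.MeasureTheory.Integral.Bochner.Set
import Mathlib.MeasureTheory.Integral.Bochner.ContinuousLinearMap

/-!
# The space `𝓜_{c,C}`: uniform tails and the continuity of `ν ↦ ν[f]` (DKLM 2026, Part II, Lemma 31)

H. Duminil-Copin, K. K. Kozlowski, P. Lammers, I. Manolescu, *Gaussian free field convergence of
the six-vertex model with `-1 ≤ Δ ≤ -1/2`*, arXiv:2603.06268 (2026) [DKLM2026SixVertexGFF]
(`paper:arxiv-2603.06268`, chunk p0023):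

> We endow `𝓜_{c,C}` with the weak (or vague) topology, that is, the topology making the map
> `ν ↦ ν[f]` continuous for any continuous function `f : ℝ_{>0} × ℝ → ℝ` whose support is a compact
> subset of `ℝ_{>0} × ℝ`. […]
>
> **Lemma 31** (Properties of `𝓜`). (i) `𝓜` is a compact topological space, (ii) Suppose that
> `f : ℝ_{>0} × ℝ → ℂ` is a continuous function such that `sup_{a,b} (a ∨ 1/a)|f(a,b)| < ∞`, then the
> function `𝓜 → ℂ, ν ↦ ν[f]` is continuous, (iii) Let `(ν_n)_n ⊂ 𝓜` denote a sequence of measures,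
> and let `(f_n)_n` denote a sequence of continuous functions `f_n : ℝ_{>0} × ℝ → ℂ` such that
> `sup_{n,a,b} (a ∨ 1/a)|f_n(a,b)| < ∞`. If `(ν_n)_n` converges to `ν` and `(f_n)_n` converges
> uniformly on every compact subset of `ℝ_{>0} × ℝ` to a function `f`, then
> `lim_{n → ∞} ν_n[f_n] → ν[f]`. (We leave it as a straightforward exercise to the reader.)

This file carries out the exercise for (ii) and (iii) in sequential form. The key input is a
**uniform tail estimate**: the `(a ∧ 1/a)`-weighted mass of `ν ∈ 𝓜_{c,C}` outside the compact
rectangles `[2^{-J}, 2^J] × [-B, B]` is small uniformly in `ν` (dyadic decompositions and the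
bounds (i), (ii) of Definition 29).

* `dklmSpaceM_lintegral_aTail_le` — `∫_{a ∉ (2^{-J},2^J]} (a ∧ 1/a) dν ≤ 16 C 2^{-J}`;
* `dklmSpaceM_measure_bTail_le` — `ν{a < α, |b| > B} ≤ 2C (α/B)^c / (1 - 2^{-c})` (`B ≥ α`);
* `HalfPlaneVagueTendsto` — vague convergence tested on `C_c(ℝ_{>0} × ℝ)`;
* **`dklmSpaceM_tendsto_integral` — Lemma 31 (iii)** (and (ii) as the special case `f_n = f`,
  `dklmSpaceM_tendsto_integral_of_vague`).

## References

* H. Duminil-Copin, K. K. Kozlowski, P. Lammers, I. Manolescu, arXiv:2603.06268 (2026), Part II,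
  Definition 29 and Lemma 31. [DKLM2026SixVertexGFF]
-/

noncomputable section

open MeasureTheory Set Filter Topology

namespace Literature.Probability.LatticeModels.SixVertex

variable {c C : ℝ} {ν : Measure (ℝ × ℝ)}

/-! ## 1. Uniform tails in `a` -/

/-- `2·2^{-n}` in `ℝ≥0∞`. [folklore] -/
theorem ofReal_two_mul_two_zpow_neg (n : ℕ) :
    ENNReal.ofReal (2 * (2 : ℝ) ^ (-(n : ℤ))) = 2 * (2⁻¹ : ENNReal) ^ n := by
  rw [ENNReal.ofReal_mul zero_le_two, ENNReal.ofReal_ofNat, zpow_neg, zpow_natCast, ← inv_pow,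
    ENNReal.ofReal_pow (by norm_num), ENNReal.ofReal_inv_of_pos (by norm_num), ENNReal.ofReal_ofNat]

/-- `∫ r (𝟙_s + 𝟙_t) dν = r (ν s + ν t)`. [folklore] -/
theorem lintegral_mul_two_indicators (ν : Measure (ℝ × ℝ)) (r : ENNReal) {s t : Set (ℝ × ℝ)}
    (hs : MeasurableSet s) (ht : MeasurableSet t) :
    ∫⁻ p, r * (s.indicator 1 p + t.indicator 1 p) ∂ν = r * (ν s + ν t) := by
  have hm : Measurable (s.indicator (1 : ℝ × ℝ → ENNReal) + t.indicator 1) :=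
    (measurable_one.indicator hs).add (measurable_one.indicator ht)
  calc ∫⁻ p, r * (s.indicator 1 p + t.indicator 1 p) ∂ν
      = ∫⁻ p, r * ((s.indicator (1 : ℝ × ℝ → ENNReal) + t.indicator (1 : ℝ × ℝ → ENNReal) : ℝ × ℝ → ENNReal) p) ∂ν := rfl
    _ = r * ∫⁻ p, ((s.indicator (1 : ℝ × ℝ → ENNReal) + t.indicator (1 : ℝ × ℝ → ENNReal) : ℝ × ℝ → ENNReal) p) ∂ν :=
        lintegral_const_mul r hm
    _ = r * (ν s + ν t) := by
        simp only [Pi.add_apply]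
        rw [lintegral_add_left (measurable_one.indicator hs), lintegral_indicator_one hs,
          lintegral_indicator_one ht]

/-- **Uniform tail estimate in `a`**: `∫_{a ∉ (2^{-J}, 2^J]} (a ∧ 1/a) dν ≤ 16 C 2^{-J}` for every
`ν ∈ 𝓜_{c,C}`. [cite: DKLM2026SixVertexGFF, Part II, Definition 29 (i) and Lemma 31] -/
theorem dklmSpaceM_lintegral_aTail_le (h : ν ∈ dklmSpaceM c C) (J : ℕ) :
    ∫⁻ p in {p : ℝ × ℝ | p.1 ∉ Ioc ((2 : ℝ) ^ (-(J : ℤ))) ((2 : ℝ) ^ (J : ℤ))}, ENNReal.ofReal (min p.1 p.1⁻¹) ∂ν ≤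
      16 * ENNReal.ofReal C * (2⁻¹ : ENNReal) ^ J := by
  set T := {p : ℝ × ℝ | p.1 ∉ Ioc ((2 : ℝ) ^ (-(J : ℤ))) ((2 : ℝ) ^ (J : ℤ))} with hT
  have hTm : MeasurableSet T := (measurableSet_Ioc.preimage measurable_fst).compl
  set w : ℕ → ENNReal := fun m => ENNReal.ofReal (2 * (2 : ℝ) ^ (-((m + J : ℕ) : ℤ))) with hw
  set g : ℕ → (ℝ × ℝ) → ENNReal := fun m p =>
    w m * ((aStrip ((m + J : ℕ) : ℤ)).indicator 1 p + (aStrip (-((m + J : ℕ) : ℤ) - 1)).indicator 1 p) with hg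
  have hgm : ∀ m, Measurable (g m) := fun m =>
    ((measurable_one.indicator (measurableSet_aStrip _)).add
      (measurable_one.indicator (measurableSet_aStrip _))).const_mul _
  -- pointwise bound on the tail
  have hpt : ∀ p ∈ T, ENNReal.ofReal (min p.1 p.1⁻¹) ≤ ∑' m, g m p := by
    intro p hpT
    rcases le_or_gt p.1 0 with hp | hp
    · rw [ENNReal.ofReal_of_nonpos ((min_le_left _ _).trans hp)]; exact zero_le
    obtain ⟨j, hj⟩ := exists_mem_Ioc_zpow hp (one_lt_two (α := ℝ))
    have hjJ : (J : ℤ) ≤ j ∨ j ≤ -(J : ℤ) - 1 := by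
      by_contra hcon
      push Not at hcon
      apply hpT
      refine ⟨lt_of_le_of_lt (zpow_le_zpow_right₀ one_le_two (by omega)) hj.1,
        hj.2.trans (zpow_le_zpow_right₀ one_le_two (by omega))⟩
    have hb := min_inv_le_of_mem_dyadic hj
    rcases hjJ with hjJ | hjJ
    · obtain ⟨m, rfl⟩ : ∃ m : ℕ, j = ((m + J : ℕ) : ℤ) := ⟨(j - J).toNat, by push_cast; omega⟩
      refine le_trans ?_ (ENNReal.le_tsum m)
      rw [hg]
      calc ENNReal.ofReal (min p.1 p.1⁻¹) ≤ w m := by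
            rw [hw]; rw [Int.abs_natCast] at hb; exact ENNReal.ofReal_le_ofReal hb
        _ = w m * 1 := (mul_one _).symm
        _ ≤ w m * ((aStrip ((m + J : ℕ) : ℤ)).indicator 1 p + (aStrip (-((m + J : ℕ) : ℤ) - 1)).indicator 1 p) := by
            gcongr
            rw [indicator_of_mem (show p ∈ aStrip ((m + J : ℕ) : ℤ) from hj), Pi.one_apply]
            exact le_self_add
    · obtain ⟨m, rfl⟩ : ∃ m : ℕ, j = -((m + J : ℕ) : ℤ) - 1 := ⟨(-j - 1 - J).toNat, by push_cast; omega⟩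
      refine le_trans ?_ (ENNReal.le_tsum m)
      rw [hg]
      calc ENNReal.ofReal (min p.1 p.1⁻¹) ≤ w m := by
            rw [hw]
            refine (ENNReal.ofReal_le_ofReal hb).trans (ENNReal.ofReal_le_ofReal ?_)
            rw [show |(-((m + J : ℕ) : ℤ) - 1)| = ((m + J : ℕ) : ℤ) + 1 by
              rw [show -((m + J : ℕ) : ℤ) - 1 = -(((m + J : ℕ) : ℤ) + 1) by ring, abs_neg]; exact abs_of_nonneg (by positivity)]
            gcongr
            · norm_num
            · omega
        _ = w m * 1 := (mul_one _).symm
        _ ≤ w m * ((aStrip ((m + J : ℕ) : ℤ)).indicator 1 p + (aStrip (-((m + J : ℕ) : ℤ) - 1)).indicator 1 p) := by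
            gcongr
            rw [indicator_of_mem (show p ∈ aStrip (-((m + J : ℕ) : ℤ) - 1) from hj), Pi.one_apply]
            exact le_add_self
  -- integrate
  have hsum : ∑' m, w m = 4 * (2⁻¹ : ENNReal) ^ J := by
    have : ∀ m, w m = 2 * (2⁻¹ : ENNReal) ^ J * (2⁻¹ : ENNReal) ^ m := by
      intro m; rw [hw]; dsimp only; rw [ofReal_two_mul_two_zpow_neg, pow_add]; ring
    simp_rw [this, ENNReal.tsum_mul_left, ENNReal.tsum_geometric, ENNReal.one_sub_inv_two, inv_inv]
    ring
  calc ∫⁻ p in T, ENNReal.ofReal (min p.1 p.1⁻¹) ∂ν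
      ≤ ∫⁻ p in T, ∑' m, g m p ∂ν := setLIntegral_mono' hTm hpt
    _ ≤ ∫⁻ p, ∑' m, g m p ∂ν := setLIntegral_le_lintegral T _
    _ = ∑' m, ∫⁻ p, g m p ∂ν := lintegral_tsum fun m => (hgm m).aemeasurable
    _ = ∑' m, w m * (ν (aStrip ((m + J : ℕ) : ℤ)) + ν (aStrip (-((m + J : ℕ) : ℤ) - 1))) := by
        refine tsum_congr fun m => ?_
        rw [hg]
        exact lintegral_mul_two_indicators ν (w m) (measurableSet_aStrip _) (measurableSet_aStrip _)
    _ ≤ ∑' m, w m * (2 * ENNReal.ofReal C + 2 * ENNReal.ofReal C) :=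
        ENNReal.tsum_le_tsum fun m => by
          gcongr <;> exact dklmSpaceM_measure_dyadic_le h _
    _ = 16 * ENNReal.ofReal C * (2⁻¹ : ENNReal) ^ J := by
        rw [ENNReal.tsum_mul_right, hsum]; ring

/-! ## 2. Uniform tails in `b` -/

/-- A `b`-shell `{a ∈ (0,α), |b| ∈ (β, 2β]}` has mass `≤ 2C(α/β)^c` (two instances of bound (ii),
`c ≥ 0`, `C ≥ 0`, `β ≥ α`). [cite: DKLM2026SixVertexGFF, Part II, Definition 29 (ii)] -/
theorem dklmSpaceM_measure_bShell_le (h : ν ∈ dklmSpaceM c C) (hc : 0 ≤ c) (hC : 0 ≤ C) {α β : ℝ}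
    (hα : 0 < α) (hαβ : α ≤ β) :
    ν {p : ℝ × ℝ | p.1 ∈ Ioo 0 α ∧ |p.2| ∈ Ioc β (2 * β)} ≤ 2 * ENNReal.ofReal (C * (α / β) ^ c) := by
  have hβ : 0 < β := hα.trans_le hαβ
  calc ν {p : ℝ × ℝ | p.1 ∈ Ioo 0 α ∧ |p.2| ∈ Ioc β (2 * β)}
      ≤ ν ({p : ℝ × ℝ | p.1 ∈ Ioo 0 α ∧ |p.2| ∈ Ioo β (2 * β)} ∪
          {p : ℝ × ℝ | p.1 ∈ Ioo 0 α ∧ |p.2| ∈ Ioo ((3 / 2) * β) (2 * ((3 / 2) * β))}) := by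
        refine measure_mono fun p hp => ?_
        simp only [mem_setOf_eq, mem_Ioc] at hp
        simp only [mem_union, mem_setOf_eq, mem_Ioo]
        by_cases hlt : |p.2| < 2 * β
        · exact Or.inl ⟨hp.1, hp.2.1, hlt⟩
        · right; exact ⟨hp.1, by nlinarith [hp.2.2], by nlinarith [hp.2.2]⟩
    _ ≤ ν {p : ℝ × ℝ | p.1 ∈ Ioo 0 α ∧ |p.2| ∈ Ioo β (2 * β)} +
          ν {p : ℝ × ℝ | p.1 ∈ Ioo 0 α ∧ |p.2| ∈ Ioo ((3 / 2) * β) (2 * ((3 / 2) * β))} := measure_union_le _ _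
    _ ≤ ENNReal.ofReal (C * (α / β) ^ c) + ENNReal.ofReal (C * (α / ((3 / 2) * β)) ^ c) :=
        add_le_add (dklmSpaceM_bound_ii h hα hαβ) (dklmSpaceM_bound_ii h hα (by linarith))
    _ ≤ ENNReal.ofReal (C * (α / β) ^ c) + ENNReal.ofReal (C * (α / β) ^ c) := by
        gcongr _ + ENNReal.ofReal (C * ?_)
        refine Real.rpow_le_rpow (by positivity) ?_ hc
        rw [div_le_div_iff_of_pos_left hα (by positivity) hβ]
        linarith
    _ = 2 * ENNReal.ofReal (C * (α / β) ^ c) := (two_mul _).symm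

/-- **Uniform tail estimate in `b`**: `ν{a ∈ (0,α), |b| > B} ≤ 2C (α/B)^c (1 - 2^{-c})⁻¹` for
`ν ∈ 𝓜_{c,C}`, `c > 0`, `C ≥ 0`, `B ≥ α > 0` (dyadic shells in `|b|` and bound (ii)).
[cite: DKLM2026SixVertexGFF, Part II, Definition 29 (ii) and Lemma 31] -/
theorem dklmSpaceM_measure_bTail_le (h : ν ∈ dklmSpaceM c C) (hc : 0 < c) (hC : 0 ≤ C) {α B : ℝ}
    (hα : 0 < α) (hαB : α ≤ B) :
    ν {p : ℝ × ℝ | p.1 ∈ Ioo 0 α ∧ B < |p.2|} ≤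
      2 * ENNReal.ofReal (C * (α / B) ^ c) * (1 - ENNReal.ofReal ((2⁻¹ : ℝ) ^ c))⁻¹ := by
  have hB : 0 < B := hα.trans_le hαB
  -- cover by the shells `(2^k B, 2^{k+1} B]`, `k ∈ ℕ`
  have hcover : {p : ℝ × ℝ | p.1 ∈ Ioo 0 α ∧ B < |p.2|} ⊆
      ⋃ k : ℕ, {p : ℝ × ℝ | p.1 ∈ Ioo 0 α ∧ |p.2| ∈ Ioc ((2 : ℝ) ^ k * B) (2 * ((2 : ℝ) ^ k * B))} := by
    intro p hp
    have hx : 0 < |p.2| / B := div_pos (hB.trans hp.2) hB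
    obtain ⟨k, hk⟩ := exists_mem_Ioc_zpow hx (one_lt_two (α := ℝ))
    have hk0 : 0 ≤ k := by
      by_contra hneg
      push Not at hneg
      have h1 : |p.2| / B ≤ (2 : ℝ) ^ (k + 1) := hk.2
      have h2 : (2 : ℝ) ^ (k + 1) ≤ 2 ^ (0 : ℤ) := zpow_le_zpow_right₀ one_le_two (by omega)
      rw [zpow_zero] at h2
      have : |p.2| / B ≤ 1 := h1.trans h2
      rw [div_le_one hB] at this
      linarith [hp.2]
    obtain ⟨n, rfl⟩ : ∃ n : ℕ, k = n := ⟨k.toNat, (Int.toNat_of_nonneg hk0).symm⟩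
    refine mem_iUnion.2 ⟨n, hp.1, ?_, ?_⟩
    · have := hk.1; rw [zpow_natCast, lt_div_iff₀ hB] at this; exact this
    · have := hk.2; rw [zpow_add_one₀ two_ne_zero, zpow_natCast, div_le_iff₀ hB] at this; linarith
  -- shell masses
  have hshell : ∀ k : ℕ, ν {p : ℝ × ℝ | p.1 ∈ Ioo 0 α ∧ |p.2| ∈ Ioc ((2 : ℝ) ^ k * B) (2 * ((2 : ℝ) ^ k * B))} ≤
      2 * ENNReal.ofReal (C * (α / B) ^ c) * ENNReal.ofReal ((2⁻¹ : ℝ) ^ c) ^ k := by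
    intro k
    have h2k : (1 : ℝ) ≤ 2 ^ k := one_le_pow₀ one_le_two
    refine (dklmSpaceM_measure_bShell_le h hc.le hC hα (hαB.trans (le_mul_of_one_le_left hB.le h2k))).trans
      (le_of_eq ?_)
    rw [mul_assoc, ← ENNReal.ofReal_pow (by positivity), ← ENNReal.ofReal_mul (by positivity)]
    congr 2
    rw [mul_assoc]
    congr 1
    rw [show α / (2 ^ k * B) = (α / B) * (2⁻¹) ^ k by rw [inv_pow]; field_simp,
      Real.mul_rpow (by positivity) (by positivity), ← Real.rpow_natCast ((2⁻¹ : ℝ) ^ c) k,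
      ← Real.rpow_mul (by positivity), mul_comm c, Real.rpow_mul (by positivity), Real.rpow_natCast]
  calc ν {p : ℝ × ℝ | p.1 ∈ Ioo 0 α ∧ B < |p.2|}
      ≤ ν (⋃ k : ℕ, {p : ℝ × ℝ | p.1 ∈ Ioo 0 α ∧ |p.2| ∈ Ioc ((2 : ℝ) ^ k * B) (2 * ((2 : ℝ) ^ k * B))}) :=
        measure_mono hcover
    _ ≤ ∑' k : ℕ, ν {p : ℝ × ℝ | p.1 ∈ Ioo 0 α ∧ |p.2| ∈ Ioc ((2 : ℝ) ^ k * B) (2 * ((2 : ℝ) ^ k * B))} :=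
        measure_iUnion_le _
    _ ≤ ∑' k : ℕ, 2 * ENNReal.ofReal (C * (α / B) ^ c) * ENNReal.ofReal ((2⁻¹ : ℝ) ^ c) ^ k :=
        ENNReal.tsum_le_tsum hshell
    _ = 2 * ENNReal.ofReal (C * (α / B) ^ c) * (1 - ENNReal.ofReal ((2⁻¹ : ℝ) ^ c))⁻¹ := by
        rw [ENNReal.tsum_mul_left, ENNReal.tsum_geometric]


/-! ## 3. Tails outside the compact rectangles `[2^{-J}, 2^J] × [-B, B]` -/

/-- The compact rectangles `K_{J,B} := [2^{-J}, 2^J] × [-B, B] ⊂ ℝ_{>0} × ℝ`. [folklore] -/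
def tailRect (J : ℕ) (B : ℝ) : Set (ℝ × ℝ) :=
  Icc ((2 : ℝ) ^ (-(J : ℤ))) ((2 : ℝ) ^ (J : ℤ)) ×ˢ Icc (-B) B

/-- `K_{J,B}` is compact. [folklore] -/
theorem isCompact_tailRect (J : ℕ) (B : ℝ) : IsCompact (tailRect J B) := isCompact_Icc.prod isCompact_Icc

/-- `K_{J,B}` is closed. [folklore] -/
theorem isClosed_tailRect (J : ℕ) (B : ℝ) : IsClosed (tailRect J B) := isClosed_Icc.prod isClosed_Icc

/-- `K_{J,B}` is measurable. [folklore] -/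
theorem measurableSet_tailRect (J : ℕ) (B : ℝ) : MeasurableSet (tailRect J B) :=
  (isClosed_tailRect J B).measurableSet

/-- `K_{J,B}` lies in the open right half-plane. [folklore] -/
theorem tailRect_subset_pos (J : ℕ) (B : ℝ) : tailRect J B ⊆ {p : ℝ × ℝ | 0 < p.1} :=
  fun _ hp => (zpow_pos two_pos _).trans_le hp.1.1

/-- `a ∧ 1/a ≤ 1`. [folklore] -/
theorem min_inv_le_one (a : ℝ) : min a a⁻¹ ≤ 1 := by
  rcases le_or_gt a 1 with h | h
  · exact (min_le_left _ _).trans h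
  · exact (min_le_right _ _).trans (inv_le_one_of_one_le₀ h.le)

/-- `a ∧ 1/a > 0` for `a > 0`. [folklore] -/
theorem min_inv_pos {a : ℝ} (ha : 0 < a) : 0 < min a a⁻¹ := lt_min ha (inv_pos.2 ha)

/-- The complement of `K_{J,B}` is covered by the `a`-tail and the `b`-tail. [folklore] -/
theorem compl_tailRect_subset (J : ℕ) (B : ℝ) :
    (tailRect J B)ᶜ ⊆ {p : ℝ × ℝ | p.1 ∉ Ioc ((2 : ℝ) ^ (-(J : ℤ))) ((2 : ℝ) ^ (J : ℤ))} ∪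
      {p : ℝ × ℝ | p.1 ∈ Ioo 0 ((2 : ℝ) ^ ((J : ℤ) + 1)) ∧ B < |p.2|} := by
  intro p hp
  by_cases ha : p.1 ∈ Ioc ((2 : ℝ) ^ (-(J : ℤ))) ((2 : ℝ) ^ (J : ℤ))
  · right
    refine ⟨⟨(zpow_pos two_pos _).trans ha.1, ha.2.trans_lt (zpow_lt_zpow_right₀ one_lt_two (by omega))⟩, ?_⟩
    by_contra hb
    push Not at hb
    exact hp ⟨⟨ha.1.le, ha.2⟩, abs_le.1 hb⟩
  · exact Or.inl ha

/-- **Uniform tail estimate**: the `(a ∧ 1/a)`-weighted mass of `ν ∈ 𝓜_{c,C}` outside `K_{J,B}` is at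
most `16 C 2^{-J} + 2C (2^{J+1}/B)^c (1 - 2^{-c})⁻¹` (`B ≥ 2^{J+1}`), uniformly in `ν`.
[cite: DKLM2026SixVertexGFF, Part II, Definition 29 and Lemma 31] -/
theorem dklmSpaceM_lintegral_compl_tailRect_le (h : ν ∈ dklmSpaceM c C) (hc : 0 < c) (hC : 0 ≤ C) (J : ℕ)
    {B : ℝ} (hB : (2 : ℝ) ^ ((J : ℤ) + 1) ≤ B) :
    ∫⁻ p in (tailRect J B)ᶜ, ENNReal.ofReal (min p.1 p.1⁻¹) ∂ν ≤
      16 * ENNReal.ofReal C * (2⁻¹ : ENNReal) ^ J +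
        2 * ENNReal.ofReal (C * ((2 : ℝ) ^ ((J : ℤ) + 1) / B) ^ c) * (1 - ENNReal.ofReal ((2⁻¹ : ℝ) ^ c))⁻¹ := by
  have hα : (0 : ℝ) < 2 ^ ((J : ℤ) + 1) := zpow_pos two_pos _
  calc ∫⁻ p in (tailRect J B)ᶜ, ENNReal.ofReal (min p.1 p.1⁻¹) ∂ν
      ≤ ∫⁻ p in {p : ℝ × ℝ | p.1 ∉ Ioc ((2 : ℝ) ^ (-(J : ℤ))) ((2 : ℝ) ^ (J : ℤ))} ∪
          {p : ℝ × ℝ | p.1 ∈ Ioo 0 ((2 : ℝ) ^ ((J : ℤ) + 1)) ∧ B < |p.2|}, ENNReal.ofReal (min p.1 p.1⁻¹) ∂ν :=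
        lintegral_mono_set (compl_tailRect_subset J B)
    _ ≤ (∫⁻ p in {p : ℝ × ℝ | p.1 ∉ Ioc ((2 : ℝ) ^ (-(J : ℤ))) ((2 : ℝ) ^ (J : ℤ))}, ENNReal.ofReal (min p.1 p.1⁻¹) ∂ν) +
          ∫⁻ p in {p : ℝ × ℝ | p.1 ∈ Ioo 0 ((2 : ℝ) ^ ((J : ℤ) + 1)) ∧ B < |p.2|}, ENNReal.ofReal (min p.1 p.1⁻¹) ∂ν :=
        lintegral_union_le _ _ _
    _ ≤ 16 * ENNReal.ofReal C * (2⁻¹ : ENNReal) ^ J +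
          ∫⁻ _ in {p : ℝ × ℝ | p.1 ∈ Ioo 0 ((2 : ℝ) ^ ((J : ℤ) + 1)) ∧ B < |p.2|}, 1 ∂ν :=
        add_le_add (dklmSpaceM_lintegral_aTail_le h J)
          (lintegral_mono fun p => ENNReal.ofReal_le_one.2 (min_inv_le_one _))
    _ = 16 * ENNReal.ofReal C * (2⁻¹ : ENNReal) ^ J +
          ν {p : ℝ × ℝ | p.1 ∈ Ioo 0 ((2 : ℝ) ^ ((J : ℤ) + 1)) ∧ B < |p.2|} := by rw [setLIntegral_one]
    _ ≤ _ := add_le_add le_rfl (dklmSpaceM_measure_bTail_le h hc hC hα hB)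

/-- The same bound for the real number `(∫_{K_{J,B}ᶜ} (a ∧ 1/a) dν)`. [cite: DKLM2026SixVertexGFF, Part II, Lemma 31] -/
theorem dklmSpaceM_toReal_lintegral_compl_tailRect_le (h : ν ∈ dklmSpaceM c C) (hc : 0 < c) (hC : 0 ≤ C) (J : ℕ)
    {B : ℝ} (hB : (2 : ℝ) ^ ((J : ℤ) + 1) ≤ B) :
    (∫⁻ p in (tailRect J B)ᶜ, ENNReal.ofReal (min p.1 p.1⁻¹) ∂ν).toReal ≤
      16 * C * (2⁻¹ : ℝ) ^ J + 2 * (C * ((2 : ℝ) ^ ((J : ℤ) + 1) / B) ^ c) * (1 - (2⁻¹ : ℝ) ^ c)⁻¹ := by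
  have hr : (2⁻¹ : ℝ) ^ c < 1 := Real.rpow_lt_one (by norm_num) (by norm_num) hc
  have hr0 : 0 ≤ (2⁻¹ : ℝ) ^ c := by positivity
  have hpos : 0 ≤ 16 * C * (2⁻¹ : ℝ) ^ J + 2 * (C * ((2 : ℝ) ^ ((J : ℤ) + 1) / B) ^ c) * (1 - (2⁻¹ : ℝ) ^ c)⁻¹ := by
    have : 0 < 1 - (2⁻¹ : ℝ) ^ c := by linarith
    have hα : (0 : ℝ) ≤ 2 ^ ((J : ℤ) + 1) / B := div_nonneg (zpow_pos two_pos _).le ((zpow_pos two_pos _).le.trans hB)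
    positivity
  refine ENNReal.toReal_le_of_le_ofReal hpos ((dklmSpaceM_lintegral_compl_tailRect_le h hc hC J hB).trans (le_of_eq ?_))
  have hr1 : 0 < 1 - (2⁻¹ : ℝ) ^ c := by linarith
  have hα : (0 : ℝ) ≤ 2 ^ ((J : ℤ) + 1) / B := div_nonneg (zpow_pos two_pos _).le ((zpow_pos two_pos _).le.trans hB)
  have e1 : ENNReal.ofReal (16 * C * (2⁻¹ : ℝ) ^ J) = 16 * ENNReal.ofReal C * (2⁻¹ : ENNReal) ^ J := by
    rw [ENNReal.ofReal_mul (by positivity : (0 : ℝ) ≤ 16 * C), ENNReal.ofReal_mul (by norm_num : (0 : ℝ) ≤ 16),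
      ENNReal.ofReal_ofNat, ENNReal.ofReal_pow (by norm_num), ENNReal.ofReal_inv_of_pos two_pos, ENNReal.ofReal_ofNat]
  have e2 : ENNReal.ofReal (2 * (C * ((2 : ℝ) ^ ((J : ℤ) + 1) / B) ^ c) * (1 - (2⁻¹ : ℝ) ^ c)⁻¹) =
      2 * ENNReal.ofReal (C * ((2 : ℝ) ^ ((J : ℤ) + 1) / B) ^ c) * (1 - ENNReal.ofReal ((2⁻¹ : ℝ) ^ c))⁻¹ := by
    rw [ENNReal.ofReal_mul (by positivity : (0 : ℝ) ≤ 2 * (C * ((2 : ℝ) ^ ((J : ℤ) + 1) / B) ^ c)),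
      ENNReal.ofReal_mul zero_le_two, ENNReal.ofReal_ofNat, ENNReal.ofReal_inv_of_pos hr1, ENNReal.ofReal_sub _ hr0,
      ENNReal.ofReal_one]
  rw [ENNReal.ofReal_add (by positivity) (by positivity), e1, e2]

/-- The `a`-bounded region `{a ∈ [2^{-J}, 2^{J}]}` has mass at most `(2J+1) · 2C` (it is covered by
`2J+1` dyadic strips). [cite: DKLM2026SixVertexGFF, Part II, Definition 29 (i)] -/
theorem dklmSpaceM_measure_aIcc_le (h : ν ∈ dklmSpaceM c C) (J : ℕ) :
    ν {p : ℝ × ℝ | p.1 ∈ Icc ((2 : ℝ) ^ (-(J : ℤ))) ((2 : ℝ) ^ (J : ℤ))} ≤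
      ((2 * J + 1 : ℕ) : ENNReal) * (2 * ENNReal.ofReal C) := by
  have hcov : {p : ℝ × ℝ | p.1 ∈ Icc ((2 : ℝ) ^ (-(J : ℤ))) ((2 : ℝ) ^ (J : ℤ))} ⊆
      ⋃ j ∈ Finset.Icc (-(J : ℤ) - 1) ((J : ℤ) - 1), aStrip j := by
    intro p hp
    have hp0 : 0 < p.1 := (zpow_pos two_pos _).trans_le hp.1
    obtain ⟨j, hj⟩ := exists_mem_Ioc_zpow hp0 (one_lt_two (α := ℝ))
    refine mem_iUnion₂.2 ⟨j, Finset.mem_Icc.2 ⟨?_, ?_⟩, hj⟩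
    · by_contra hlt
      push Not at hlt
      have h2 : (2 : ℝ) ^ (j + 1) ≤ 2 ^ (-(J : ℤ) - 1) := zpow_le_zpow_right₀ one_le_two (by omega)
      have h3 : (2 : ℝ) ^ (-(J : ℤ) - 1) < 2 ^ (-(J : ℤ)) := zpow_lt_zpow_right₀ one_lt_two (by omega)
      linarith [hp.1, hj.2]
    · by_contra hlt
      push Not at hlt
      have h2 : (2 : ℝ) ^ (J : ℤ) ≤ 2 ^ j := zpow_le_zpow_right₀ one_le_two (by omega)
      linarith [hp.2, hj.1]
  calc ν {p : ℝ × ℝ | p.1 ∈ Icc ((2 : ℝ) ^ (-(J : ℤ))) ((2 : ℝ) ^ (J : ℤ))}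
      ≤ ν (⋃ j ∈ Finset.Icc (-(J : ℤ) - 1) ((J : ℤ) - 1), aStrip j) := measure_mono hcov
    _ ≤ ∑ j ∈ Finset.Icc (-(J : ℤ) - 1) ((J : ℤ) - 1), ν (aStrip j) := measure_biUnion_finset_le _ _
    _ ≤ (Finset.Icc (-(J : ℤ) - 1) ((J : ℤ) - 1)).card • (2 * ENNReal.ofReal C) :=
        Finset.sum_le_card_nsmul _ _ _ fun j _ => dklmSpaceM_measure_dyadic_le h j
    _ = ((2 * J + 1 : ℕ) : ENNReal) * (2 * ENNReal.ofReal C) := by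
        rw [Int.card_Icc, show ((J : ℤ) - 1 + 1 - (-(J : ℤ) - 1)).toNat = 2 * J + 1 by omega, nsmul_eq_mul]

/-! ## 4. Integrability against `ν ∈ 𝓜` -/

/-- `ν ∈ 𝓜` lives on the open right half-plane. [cite: DKLM2026SixVertexGFF, Part II, Definition 29] -/
theorem dklmSpaceM_ae_pos (h : ν ∈ dklmSpaceM c C) : ∀ᵐ p ∂ν, 0 < p.1 := by
  rw [ae_iff]
  simpa only [not_lt] using dklmSpaceM_nonpos_null h

/-- The open right half-plane is measurable. [folklore] -/
theorem measurableSet_pos : MeasurableSet {p : ℝ × ℝ | 0 < p.1} :=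
  measurableSet_lt measurable_const measurable_fst

/-- The open right half-plane is open. [folklore] -/
theorem isOpen_pos : IsOpen {p : ℝ × ℝ | 0 < p.1} := isOpen_lt continuous_const continuous_fst

/-- Restricting `ν ∈ 𝓜` to the half-plane does nothing. [cite: DKLM2026SixVertexGFF, Part II, Definition 29] -/
theorem dklmSpaceM_restrict_pos (h : ν ∈ dklmSpaceM c C) : ν.restrict {p : ℝ × ℝ | 0 < p.1} = ν :=
  Measure.restrict_eq_self_of_ae_mem (dklmSpaceM_ae_pos h)

/-- A function continuous on the half-plane is `ν`-a.e. strongly measurable for `ν ∈ 𝓜`. [folklore] -/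
theorem dklmSpaceM_aestronglyMeasurable (h : ν ∈ dklmSpaceM c C) {E : Type*} [NormedAddCommGroup E]
    {g : ℝ × ℝ → E} (hg : ContinuousOn g {p : ℝ × ℝ | 0 < p.1}) : AEStronglyMeasurable g ν := by
  rw [← dklmSpaceM_restrict_pos h]
  exact hg.aestronglyMeasurable measurableSet_pos

/-- `a ∧ 1/a` is measurable. [folklore] -/
theorem measurable_min_inv : Measurable (fun p : ℝ × ℝ => min p.1 p.1⁻¹) :=
  measurable_fst.min measurable_fst.inv

/-- **Domination ⇒ integrability**: a function continuous on the half-plane with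
`(a ∨ 1/a)|g| ≤ K`, i.e. `|g| ≤ K (a ∧ 1/a)`, is `ν`-integrable for `ν ∈ 𝓜_{c,C}`.
[cite: DKLM2026SixVertexGFF, Part II §1.2.1 ("`a ∧ 1/a` is a good domination function")] -/
theorem dklmSpaceM_integrable (h : ν ∈ dklmSpaceM c C) {E : Type*} [NormedAddCommGroup E] {g : ℝ × ℝ → E}
    (hg : ContinuousOn g {p : ℝ × ℝ | 0 < p.1}) {K : ℝ} (hK0 : 0 ≤ K)
    (hK : ∀ p : ℝ × ℝ, 0 < p.1 → ‖g p‖ ≤ K * min p.1 p.1⁻¹) : Integrable g ν := by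
  refine ⟨dklmSpaceM_aestronglyMeasurable h hg, ?_⟩
  have hae : ∀ᵐ p ∂ν, ‖g p‖ₑ ≤ ENNReal.ofReal K * ENNReal.ofReal (min p.1 p.1⁻¹) := by
    filter_upwards [dklmSpaceM_ae_pos h] with p hp
    rw [← ofReal_norm, ← ENNReal.ofReal_mul hK0]
    exact ENNReal.ofReal_le_ofReal (hK p hp)
  show ∫⁻ p, ‖g p‖ₑ ∂ν < ⊤
  calc ∫⁻ p, ‖g p‖ₑ ∂ν ≤ ∫⁻ p, ENNReal.ofReal K * ENNReal.ofReal (min p.1 p.1⁻¹) ∂ν := lintegral_mono_ae hae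
    _ = ENNReal.ofReal K * ∫⁻ p, ENNReal.ofReal (min p.1 p.1⁻¹) ∂ν :=
        lintegral_const_mul _ measurable_min_inv.ennreal_ofReal
    _ ≤ ENNReal.ofReal K * (12 * ENNReal.ofReal C) := by gcongr; exact dklmSpaceM_lintegral_min_inv_le h
    _ < ⊤ := ENNReal.mul_lt_top ENNReal.ofReal_lt_top (ENNReal.mul_lt_top (by norm_num) ENNReal.ofReal_lt_top)

/-- The domination function `K (a ∧ 1/a)` itself is `ν`-integrable. [cite: DKLM2026SixVertexGFF, Part II §1.2.1] -/
theorem dklmSpaceM_integrable_min_inv (h : ν ∈ dklmSpaceM c C) {K : ℝ} (hK0 : 0 ≤ K) :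
    Integrable (fun p : ℝ × ℝ => K * min p.1 p.1⁻¹) ν := by
  refine dklmSpaceM_integrable h ?_ hK0 fun p hp => ?_
  · have hmin : ContinuousOn (fun p : ℝ × ℝ => min p.1 p.1⁻¹) {p : ℝ × ℝ | 0 < p.1} :=
      continuous_min.comp_continuousOn (continuousOn_fst.prodMk (continuousOn_fst.inv₀ fun p hp => ne_of_gt hp))
    exact continuousOn_const.mul hmin
  · rw [Real.norm_eq_abs, abs_of_nonneg (mul_nonneg hK0 (min_inv_pos hp).le)]

/-- Multiplying an integrable function by a bounded continuous real factor keeps it integrable. [folklore] -/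
theorem integrable_ofReal_mul {μ : Measure (ℝ × ℝ)} {g : ℝ × ℝ → ℂ} (hg : Integrable g μ) {ψ : ℝ × ℝ → ℝ}
    (hψ : Continuous ψ) {R : ℝ} (hR : ∀ p, |ψ p| ≤ R) : Integrable (fun p => (ψ p : ℂ) * g p) μ :=
  hg.bdd_mul (Complex.continuous_ofReal.comp hψ).aestronglyMeasurable
    (ae_of_all _ fun p => by rw [Complex.norm_real, Real.norm_eq_abs]; exact hR p)

/-- **The tail term**: if `|ψ| ≤ 1` vanishes on `K_{J,B}` and `|g| ≤ K (a ∧ 1/a)` on the half-plane,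
then `‖∫ ψ g dν‖ ≤ K ∫_{K_{J,B}ᶜ} (a ∧ 1/a) dν`. [cite: DKLM2026SixVertexGFF, Part II, Lemma 31] -/
theorem dklmSpaceM_norm_integral_tail_le (h : ν ∈ dklmSpaceM c C) {g : ℝ × ℝ → ℂ} {K : ℝ} (hK0 : 0 ≤ K)
    (hK : ∀ p : ℝ × ℝ, 0 < p.1 → ‖g p‖ ≤ K * min p.1 p.1⁻¹) {ψ : ℝ × ℝ → ℝ}
    (hψ1 : ∀ p, |ψ p| ≤ 1) (J : ℕ) (B : ℝ) (hψ0 : ∀ p ∈ tailRect J B, ψ p = 0) :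
    ‖∫ p, (ψ p : ℂ) * g p ∂ν‖ ≤ K * (∫⁻ p in (tailRect J B)ᶜ, ENNReal.ofReal (min p.1 p.1⁻¹) ∂ν).toReal := by
  have hbnd : Integrable ((tailRect J B)ᶜ.indicator fun p : ℝ × ℝ => K * min p.1 p.1⁻¹) ν :=
    (dklmSpaceM_integrable_min_inv h hK0).indicator (measurableSet_tailRect J B).compl
  have hle : ∀ᵐ p ∂ν, ‖(ψ p : ℂ) * g p‖ ≤ (tailRect J B)ᶜ.indicator (fun p : ℝ × ℝ => K * min p.1 p.1⁻¹) p := by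
    filter_upwards [dklmSpaceM_ae_pos h] with p hp
    by_cases hmem : p ∈ tailRect J B
    · rw [hψ0 p hmem, indicator_of_notMem (notMem_compl_iff.2 hmem)]
      simp
    · rw [indicator_of_mem (mem_compl hmem), norm_mul, Complex.norm_real, Real.norm_eq_abs]
      calc |ψ p| * ‖g p‖ ≤ 1 * (K * min p.1 p.1⁻¹) :=
            mul_le_mul (hψ1 p) (hK p hp) (norm_nonneg _) zero_le_one
        _ = K * min p.1 p.1⁻¹ := one_mul _
  calc ‖∫ p, (ψ p : ℂ) * g p ∂ν‖
      ≤ ∫ p, (tailRect J B)ᶜ.indicator (fun p : ℝ × ℝ => K * min p.1 p.1⁻¹) p ∂ν := norm_integral_le_of_norm_le hbnd hle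
    _ = ∫ p in (tailRect J B)ᶜ, K * min p.1 p.1⁻¹ ∂ν := integral_indicator (measurableSet_tailRect J B).compl
    _ = K * ∫ p in (tailRect J B)ᶜ, min p.1 p.1⁻¹ ∂ν := integral_const_mul _ _
    _ = K * (∫⁻ p in (tailRect J B)ᶜ, ENNReal.ofReal (min p.1 p.1⁻¹) ∂ν).toReal := by
        rw [integral_eq_lintegral_of_nonneg_ae]
        · filter_upwards [ae_restrict_of_ae (dklmSpaceM_ae_pos h)] with p hp
          exact (min_inv_pos hp).le
        · exact measurable_min_inv.aestronglyMeasurable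

/-! ## 5. Vague convergence on the half-plane and Lemma 31 (ii)–(iii) -/

/-- **Vague convergence in the sense of Definition 29's topology**: convergence of `ν_n[φ]` for
every continuous `φ` with compact support contained in the open half-plane `ℝ_{>0} × ℝ`.
[cite: DKLM2026SixVertexGFF, Part II, Definition 29] -/
def HalfPlaneVagueTendsto (νs : ℕ → Measure (ℝ × ℝ)) (ν : Measure (ℝ × ℝ)) : Prop :=
  ∀ φ : ℝ × ℝ → ℝ, Continuous φ → HasCompactSupport φ → tsupport φ ⊆ {p : ℝ × ℝ | 0 < p.1} →
    Tendsto (fun n => ∫ p, φ p ∂νs n) atTop (𝓝 (∫ p, φ p ∂ν))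

/-- Vague convergence also holds for complex-valued test functions (real and imaginary parts).
[cite: DKLM2026SixVertexGFF, Part II, Definition 29] -/
theorem HalfPlaneVagueTendsto.tendsto_integral_complex {νs : ℕ → Measure (ℝ × ℝ)} {ν : Measure (ℝ × ℝ)}
    (hv : HalfPlaneVagueTendsto νs ν) {g : ℝ × ℝ → ℂ} (hg : Continuous g) (hsupp : HasCompactSupport g)
    (hsub : tsupport g ⊆ {p : ℝ × ℝ | 0 < p.1}) (hint : ∀ n, Integrable g (νs n)) (hintν : Integrable g ν) :
    Tendsto (fun n => ∫ p, g p ∂νs n) atTop (𝓝 (∫ p, g p ∂ν)) := by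
  have hre := hv (fun p => (g p).re) (Complex.continuous_re.comp hg)
    (hsupp.comp_left (g := Complex.re) Complex.zero_re) ((tsupport_comp_subset Complex.zero_re g).trans hsub)
  have him := hv (fun p => (g p).im) (Complex.continuous_im.comp hg)
    (hsupp.comp_left (g := Complex.im) Complex.zero_im) ((tsupport_comp_subset Complex.zero_im g).trans hsub)
  have e1 : ∀ μ : Measure (ℝ × ℝ), Integrable g μ → ∫ p, (g p).re ∂μ = (∫ p, g p ∂μ).re := fun μ hμ => by
    simpa only [Complex.reCLM_apply] using Complex.reCLM.integral_comp_comm hμ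
  have e2 : ∀ μ : Measure (ℝ × ℝ), Integrable g μ → ∫ p, (g p).im ∂μ = (∫ p, g p ∂μ).im := fun μ hμ => by
    simpa only [Complex.imCLM_apply] using Complex.imCLM.integral_comp_comm hμ
  have e1n : ∀ n, ∫ p, (g p).re ∂νs n = (∫ p, g p ∂νs n).re := fun n => e1 _ (hint n)
  have e2n : ∀ n, ∫ p, (g p).im ∂νs n = (∫ p, g p ∂νs n).im := fun n => e2 _ (hint n)
  simp only [e1n, e1 _ hintν] at hre
  simp only [e2n, e2 _ hintν] at him
  have := ((Complex.continuous_ofReal.tendsto _).comp hre).add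
    (((Complex.continuous_ofReal.tendsto _).comp him).mul (tendsto_const_nhds (x := Complex.I)))
  simpa only [Function.comp_def, Complex.re_add_im] using this

/-- A product `φ · f` with `φ` continuous and supported inside the open set where `f` is continuous
is continuous everywhere. [folklore] -/
theorem continuous_ofReal_mul_of_tsupport_subset {U : Set (ℝ × ℝ)} (hU : IsOpen U) {φ : ℝ × ℝ → ℝ}
    (hφ : Continuous φ) (hsub : tsupport φ ⊆ U) {f : ℝ × ℝ → ℂ} (hf : ContinuousOn f U) :
    Continuous fun p => (φ p : ℂ) * f p := by
  rw [continuous_iff_continuousAt]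
  intro x
  by_cases hx : x ∈ U
  · exact ((Complex.continuous_ofReal.comp hφ).continuousAt).mul (hf.continuousAt (hU.mem_nhds hx))
  · have hx' : x ∉ tsupport φ := fun h' => hx (hsub h')
    rw [notMem_tsupport_iff_eventuallyEq] at hx'
    have heq : (fun _ => (0 : ℂ)) =ᶠ[𝓝 x] fun p => (φ p : ℂ) * f p :=
      hx'.mono fun p hp => by simp [hp]
    exact continuousAt_const.congr heq

/-- A constant sequence converges locally uniformly. [folklore] -/
theorem tendstoLocallyUniformlyOn_const_seq {f : ℝ × ℝ → ℂ} {U : Set (ℝ × ℝ)} :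
    TendstoLocallyUniformlyOn (fun _ : ℕ => f) f atTop U := by
  intro u hu x _
  exact ⟨U, self_mem_nhdsWithin, Eventually.of_forall fun n y _ => refl_mem_uniformity hu⟩

/-- **Lemma 31 (iii) (properties of `𝓜`)**, sequential form: if `ν_n, ν ∈ 𝓜_{c,C}` (`c > 0`,
`C ≥ 0`), `ν_n → ν` vaguely on `ℝ_{>0} × ℝ`, the `f_n` are continuous on the half-plane with
`sup_{n,a,b} (a ∨ 1/a)|f_n(a,b)| ≤ K < ∞`, and `f_n → f` uniformly on compact subsets of
`ℝ_{>0} × ℝ`, then `ν_n[f_n] → ν[f]`. [cite: DKLM2026SixVertexGFF, Part II, Lemma 31 (iii)] -/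
theorem dklmSpaceM_tendsto_integral (hc : 0 < c) (hC : 0 ≤ C) {νs : ℕ → Measure (ℝ × ℝ)}
    (hνs : ∀ n, νs n ∈ dklmSpaceM c C) (hν : ν ∈ dklmSpaceM c C) (hv : HalfPlaneVagueTendsto νs ν)
    {fs : ℕ → ℝ × ℝ → ℂ} {f : ℝ × ℝ → ℂ} (hfs : ∀ n, ContinuousOn (fs n) {p : ℝ × ℝ | 0 < p.1})
    {K : ℝ} (hK : ∀ n (p : ℝ × ℝ), 0 < p.1 → ‖fs n p‖ ≤ K * min p.1 p.1⁻¹)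
    (hlim : TendstoLocallyUniformlyOn fs f atTop {p : ℝ × ℝ | 0 < p.1}) :
    Tendsto (fun n => ∫ p, fs n p ∂νs n) atTop (𝓝 (∫ p, f p ∂ν)) := by
  have hU := isOpen_pos
  have hf : ContinuousOn f {p : ℝ × ℝ | 0 < p.1} := hlim.continuousOn (Eventually.of_forall hfs).frequently
  have hK0 : 0 ≤ K := by
    have := hK 0 (1, 0) one_pos
    simp only [inv_one, min_self, mul_one] at this
    exact (norm_nonneg _).trans this
  have hfK : ∀ p : ℝ × ℝ, 0 < p.1 → ‖f p‖ ≤ K * min p.1 p.1⁻¹ := fun p hp =>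
    le_of_tendsto' ((hlim.tendsto_at hp).norm) fun n => hK n p hp
  rw [Metric.tendsto_atTop]
  intro ε hε
  -- Step 1: the tails
  set η : ℝ := ε / (4 * (K + 1)) with hη
  have hη0 : 0 < η := by positivity
  obtain ⟨J, hJ⟩ : ∃ J : ℕ, (2⁻¹ : ℝ) ^ J < η / 2 / (16 * C + 1) :=
    exists_pow_lt_of_lt_one (by positivity) (by norm_num)
  have hJ' : 16 * C * (2⁻¹ : ℝ) ^ J ≤ η / 2 := by
    have h1 : 16 * C * (2⁻¹ : ℝ) ^ J ≤ (16 * C + 1) * (2⁻¹ : ℝ) ^ J := by gcongr; linarith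
    have h2 : (16 * C + 1) * (2⁻¹ : ℝ) ^ J ≤ (16 * C + 1) * (η / 2 / (16 * C + 1)) := by gcongr
    rw [mul_div_cancel₀ _ (by positivity : (16 * C + 1 : ℝ) ≠ 0)] at h2
    exact h1.trans h2
  set r : ℝ := (2⁻¹ : ℝ) ^ c with hr
  have hr1 : r < 1 := Real.rpow_lt_one (by norm_num) (by norm_num) hc
  have hr0 : 0 < 1 - r := by linarith
  set D : ℝ := 2 * C * (1 - r)⁻¹ + 1 with hD
  have hD0 : 0 < D := by positivity
  set sB : ℝ := min (η / 2 / D) 1 with hsB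
  have hsB0 : 0 < sB := lt_min (by positivity) one_pos
  have hsB1 : sB ≤ 1 := min_le_right _ _
  set α : ℝ := (2 : ℝ) ^ ((J : ℤ) + 1) with hαdef
  have hα0 : 0 < α := zpow_pos two_pos _
  set B : ℝ := α * sB ^ (-(1 / c)) with hBdef
  have hsBpow : 1 ≤ sB ^ (-(1 / c)) := Real.one_le_rpow_of_pos_of_le_one_of_nonpos hsB0 hsB1 (by
    rw [neg_nonpos]; positivity)
  have hαB : α ≤ B := le_mul_of_one_le_right hα0.le hsBpow
  have hquot : (α / B) ^ c = sB := by
    rw [hBdef, div_mul_cancel_left₀ hα0.ne', Real.rpow_neg hsB0.le, inv_inv, ← Real.rpow_mul hsB0.le,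
      one_div_mul_cancel hc.ne', Real.rpow_one]
  have hBtail : 2 * (C * (α / B) ^ c) * (1 - r)⁻¹ ≤ η / 2 := by
    rw [hquot, show 2 * (C * sB) * (1 - r)⁻¹ = (2 * C * (1 - r)⁻¹) * sB by ring]
    calc (2 * C * (1 - r)⁻¹) * sB ≤ D * sB := by gcongr; linarith
      _ ≤ D * (η / 2 / D) := by gcongr; exact min_le_left _ _
      _ = η / 2 := mul_div_cancel₀ _ hD0.ne'
  have htail : ∀ ν', ν' ∈ dklmSpaceM c C →
      (∫⁻ p in (tailRect J B)ᶜ, ENNReal.ofReal (min p.1 p.1⁻¹) ∂ν').toReal ≤ η := fun ν' h' => by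
    have h3 := dklmSpaceM_toReal_lintegral_compl_tailRect_le h' hc hC J hαB
    simp only [← hαdef, ← hr] at h3
    linarith [hJ', hBtail]
  -- Step 2: the cutoff `φ`
  set s : Set (ℝ × ℝ) := Ioo ((2 : ℝ) ^ (-(J : ℤ) - 1)) ((2 : ℝ) ^ ((J : ℤ) + 1)) ×ˢ Ioo (-(B + 1)) (B + 1) with hsdef
  set K' : Set (ℝ × ℝ) := Icc ((2 : ℝ) ^ (-(J : ℤ) - 1)) ((2 : ℝ) ^ ((J : ℤ) + 1)) ×ˢ Icc (-(B + 1)) (B + 1)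
    with hK'def
  have hs : IsOpen s := isOpen_Ioo.prod isOpen_Ioo
  have hK'c : IsCompact K' := isCompact_Icc.prod isCompact_Icc
  have hsK' : s ⊆ K' := prod_mono Ioo_subset_Icc_self Ioo_subset_Icc_self
  have hcls : closure s ⊆ K' := closure_minimal hsK' (isClosed_Icc.prod isClosed_Icc)
  have hclc : IsCompact (closure s) := hK'c.of_isClosed_subset isClosed_closure hcls
  have hK'U : K' ⊆ {p : ℝ × ℝ | 0 < p.1} := fun p hp => (zpow_pos two_pos _).trans_le hp.1.1
  have hB0 : 0 < B := hα0.trans_le hαB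
  have hts : tailRect J B ⊆ s := prod_mono
    (Icc_subset_Ioo (zpow_lt_zpow_right₀ one_lt_two (by omega)) (zpow_lt_zpow_right₀ one_lt_two (by omega)))
    (Icc_subset_Ioo (by linarith) (by linarith))
  obtain ⟨φ, hφs, hφ1, hφ01⟩ := exists_tsupport_one_of_isOpen_isClosed hs hclc (isClosed_tailRect J B) hts
  have hφc : Continuous φ := φ.continuous
  have hφK' : tsupport φ ⊆ K' := hφs.trans hsK'
  have hφsupp : HasCompactSupport φ := hK'c.of_isClosed_subset (isClosed_tsupport _) hφK'
  have hφU : tsupport φ ⊆ {p : ℝ × ℝ | 0 < p.1} := hφK'.trans hK'U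
  have hφabs : ∀ p, |φ p| ≤ 1 := fun p => abs_le.2 ⟨by linarith [(hφ01 p).1], (hφ01 p).2⟩
  have h1φabs : ∀ p, |1 - φ p| ≤ 1 := fun p => abs_le.2 ⟨by linarith [(hφ01 p).2], by linarith [(hφ01 p).1]⟩
  have h1φ0 : ∀ p ∈ tailRect J B, 1 - φ p = 0 := fun p hp => by rw [hφ1 hp, Pi.one_apply, sub_self]
  have hφ0 : ∀ p, p ∉ K' → φ p = 0 := fun p hp => image_eq_zero_of_notMem_tsupport fun h' => hp (hφK' h')
  -- Step 3: a uniform mass bound on `K'`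
  have hK'sub : K' ⊆ {p : ℝ × ℝ | p.1 ∈ Icc ((2 : ℝ) ^ (-((J + 1 : ℕ) : ℤ))) ((2 : ℝ) ^ ((J + 1 : ℕ) : ℤ))} := by
    intro p hp
    have e1 : (-((J + 1 : ℕ) : ℤ)) = -(J : ℤ) - 1 := by push_cast; ring
    have e2 : ((J + 1 : ℕ) : ℤ) = (J : ℤ) + 1 := by push_cast; ring
    rw [mem_setOf_eq, e1, e2]
    exact hp.1
  set Mₑ : ENNReal := ((2 * (J + 1) + 1 : ℕ) : ENNReal) * (2 * ENNReal.ofReal C) with hMₑ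
  have hMₑtop : Mₑ ≠ ⊤ :=
    ENNReal.mul_ne_top (ENNReal.natCast_ne_top _) (ENNReal.mul_ne_top (by norm_num) ENNReal.ofReal_ne_top)
  have hmass : ∀ ν', ν' ∈ dklmSpaceM c C → ν' K' ≤ Mₑ := fun ν' h' =>
    (measure_mono hK'sub).trans (dklmSpaceM_measure_aIcc_le h' (J + 1))
  set M : ℝ := Mₑ.toReal with hM
  have hM0 : 0 ≤ M := ENNReal.toReal_nonneg
  -- Step 4: uniform convergence on `K'`
  set θ : ℝ := η / (M + 1) with hθ
  have hθ0 : 0 < θ := by positivity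
  have hθM : θ * M ≤ η := by
    rw [hθ, div_mul_eq_mul_div, div_le_iff₀ (by positivity)]
    nlinarith [hM0, hη0]
  have hunif : TendstoUniformlyOn fs f atTop K' :=
    (tendstoLocallyUniformlyOn_iff_forall_isCompact hU).1 hlim K' hK'U hK'c
  obtain ⟨N₁, hN₁⟩ : ∃ N₁, ∀ n ≥ N₁, ∀ p ∈ K', dist (f p) (fs n p) < θ :=
    eventually_atTop.1 (Metric.tendstoUniformlyOn_iff.1 hunif θ hθ0)
  -- Step 5: the vague term `∫ φ f`
  set g : ℝ × ℝ → ℂ := fun p => (φ p : ℂ) * f p with hg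
  have hgc : Continuous g := continuous_ofReal_mul_of_tsupport_subset hU hφc hφU hf
  have hsuppg : Function.support g ⊆ Function.support φ := by
    intro p hp
    rw [Function.mem_support] at hp ⊢
    contrapose! hp
    simp [hg, hp]
  have hgsupp : HasCompactSupport g := hφsupp.mono hsuppg
  have hgsub : tsupport g ⊆ {p : ℝ × ℝ | 0 < p.1} := (closure_mono hsuppg).trans hφU
  have hfint : ∀ ν', ν' ∈ dklmSpaceM c C → Integrable f ν' := fun ν' h' => dklmSpaceM_integrable h' hf hK0 hfK
  have hgint : ∀ ν', ν' ∈ dklmSpaceM c C → Integrable g ν' := fun ν' h' =>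
    integrable_ofReal_mul (hfint ν' h') hφc hφabs
  have hvg := hv.tendsto_integral_complex hgc hgsupp hgsub (fun n => hgint _ (hνs n)) (hgint _ hν)
  obtain ⟨N₂, hN₂⟩ : ∃ N₂, ∀ n ≥ N₂, dist (∫ p, g p ∂νs n) (∫ p, g p ∂ν) < η :=
    Metric.tendsto_atTop.1 hvg η hη0
  -- Step 6: conclusion
  refine ⟨max N₁ N₂, fun n hn => ?_⟩
  have hn1 : N₁ ≤ n := le_of_max_le_left hn
  have hn2 : N₂ ≤ n := le_of_max_le_right hn
  have hfsint : Integrable (fs n) (νs n) := dklmSpaceM_integrable (hνs n) (hfs n) hK0 (hK n)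
  have hAint : Integrable (fun p => ((1 - φ p : ℝ) : ℂ) * fs n p) (νs n) :=
    integrable_ofReal_mul hfsint (continuous_const.sub hφc) h1φabs
  have hBint : Integrable (fun p => (φ p : ℂ) * (fs n p - f p)) (νs n) :=
    integrable_ofReal_mul (hfsint.sub (hfint _ (hνs n))) hφc hφabs
  have hDint : Integrable (fun p => ((1 - φ p : ℝ) : ℂ) * f p) ν :=
    integrable_ofReal_mul (hfint _ hν) (continuous_const.sub hφc) h1φabs
  have hABint : Integrable (fun p => ((1 - φ p : ℝ) : ℂ) * fs n p + (φ p : ℂ) * (fs n p - f p)) (νs n) :=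
    hAint.add hBint
  have hdec1 : ∫ p, fs n p ∂νs n =
      ∫ p, ((1 - φ p : ℝ) : ℂ) * fs n p ∂νs n + ∫ p, (φ p : ℂ) * (fs n p - f p) ∂νs n + ∫ p, g p ∂νs n := by
    rw [← integral_add hAint hBint, ← integral_add hABint (hgint _ (hνs n))]
    refine integral_congr_ae (Eventually.of_forall fun p => ?_)
    simp only [hg]
    push_cast
    ring
  have hdec2 : ∫ p, f p ∂ν = ∫ p, ((1 - φ p : ℝ) : ℂ) * f p ∂ν + ∫ p, g p ∂ν := by
    rw [← integral_add hDint (hgint _ hν)]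
    refine integral_congr_ae (Eventually.of_forall fun p => ?_)
    simp only [hg]
    push_cast
    ring
  -- the four bounds
  have bA : ‖∫ p, ((1 - φ p : ℝ) : ℂ) * fs n p ∂νs n‖ ≤ K * η :=
    (dklmSpaceM_norm_integral_tail_le (hνs n) hK0 (hK n) h1φabs J B h1φ0).trans
      (mul_le_mul_of_nonneg_left (htail _ (hνs n)) hK0)
  have bD : ‖∫ p, ((1 - φ p : ℝ) : ℂ) * f p ∂ν‖ ≤ K * η :=
    (dklmSpaceM_norm_integral_tail_le hν hK0 hfK h1φabs J B h1φ0).trans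
      (mul_le_mul_of_nonneg_left (htail _ hν) hK0)
  have bB : ‖∫ p, (φ p : ℂ) * (fs n p - f p) ∂νs n‖ ≤ θ * M := by
    rw [← setIntegral_eq_integral_of_forall_compl_eq_zero (s := K') (fun p hp => by simp [hφ0 p hp])]
    calc ‖∫ p in K', (φ p : ℂ) * (fs n p - f p) ∂νs n‖ ≤ θ * (νs n).real K' := by
          refine norm_setIntegral_le_of_norm_le_const ((hmass _ (hνs n)).trans_lt (lt_top_iff_ne_top.2 hMₑtop))
            fun p hp => ?_
          rw [norm_mul, Complex.norm_real, Real.norm_eq_abs]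
          have hd := hN₁ n hn1 p hp
          rw [dist_eq_norm, ← norm_neg, neg_sub] at hd
          calc |φ p| * ‖fs n p - f p‖ ≤ 1 * θ := mul_le_mul (hφabs p) hd.le (norm_nonneg _) zero_le_one
            _ = θ := one_mul θ
      _ ≤ θ * M := by
          rw [measureReal_def]
          exact mul_le_mul_of_nonneg_left (ENNReal.toReal_mono hMₑtop (hmass _ (hνs n))) hθ0.le
  have bC : ‖∫ p, g p ∂νs n - ∫ p, g p ∂ν‖ < η := by rw [← dist_eq_norm]; exact hN₂ n hn2
  have hε2 : (2 * K + 2) * η = ε / 2 := by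
    rw [hη]; field_simp; ring
  rw [dist_eq_norm, hdec1, hdec2]
  calc ‖∫ p, ((1 - φ p : ℝ) : ℂ) * fs n p ∂νs n + ∫ p, (φ p : ℂ) * (fs n p - f p) ∂νs n + ∫ p, g p ∂νs n -
          (∫ p, ((1 - φ p : ℝ) : ℂ) * f p ∂ν + ∫ p, g p ∂ν)‖
      = ‖∫ p, ((1 - φ p : ℝ) : ℂ) * fs n p ∂νs n + ∫ p, (φ p : ℂ) * (fs n p - f p) ∂νs n +
          (∫ p, g p ∂νs n - ∫ p, g p ∂ν) - ∫ p, ((1 - φ p : ℝ) : ℂ) * f p ∂ν‖ := by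
        congr 1; ring
    _ ≤ ‖∫ p, ((1 - φ p : ℝ) : ℂ) * fs n p ∂νs n + ∫ p, (φ p : ℂ) * (fs n p - f p) ∂νs n +
          (∫ p, g p ∂νs n - ∫ p, g p ∂ν)‖ + ‖∫ p, ((1 - φ p : ℝ) : ℂ) * f p ∂ν‖ := norm_sub_le _ _
    _ ≤ ‖∫ p, ((1 - φ p : ℝ) : ℂ) * fs n p ∂νs n‖ + ‖∫ p, (φ p : ℂ) * (fs n p - f p) ∂νs n‖ +
          ‖∫ p, g p ∂νs n - ∫ p, g p ∂ν‖ + ‖∫ p, ((1 - φ p : ℝ) : ℂ) * f p ∂ν‖ := by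
        gcongr; exact norm_add₃_le
    _ < K * η + η + η + K * η := by linarith [bA, bB, bC, bD, hθM]
    _ = (2 * K + 2) * η := by ring
    _ < ε := by rw [hε2]; linarith

/-- **Lemma 31 (ii) (properties of `𝓜`)**, sequential form: for a fixed `f` continuous on the
half-plane with `sup (a ∨ 1/a)|f| < ∞`, `ν ↦ ν[f]` is sequentially continuous on `𝓜_{c,C}`.
[cite: DKLM2026SixVertexGFF, Part II, Lemma 31 (ii)] -/
theorem dklmSpaceM_tendsto_integral_of_vague (hc : 0 < c) (hC : 0 ≤ C) {νs : ℕ → Measure (ℝ × ℝ)}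
    (hνs : ∀ n, νs n ∈ dklmSpaceM c C) (hν : ν ∈ dklmSpaceM c C) (hv : HalfPlaneVagueTendsto νs ν)
    {f : ℝ × ℝ → ℂ} (hf : ContinuousOn f {p : ℝ × ℝ | 0 < p.1})
    {K : ℝ} (hK : ∀ p : ℝ × ℝ, 0 < p.1 → ‖f p‖ ≤ K * min p.1 p.1⁻¹) :
    Tendsto (fun n => ∫ p, f p ∂νs n) atTop (𝓝 (∫ p, f p ∂ν)) :=
  dklmSpaceM_tendsto_integral hc hC hνs hν hv (fun _ => hf) (fun _ p hp => hK p hp)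
    tendstoLocallyUniformlyOn_const_seq

end Literature.Probability.LatticeModels.SixVertex

end
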